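import Literature.AlgebraicGeometry.Resolution.HironakaDirectrixIdeal
import Literature.AlgebraicGeometry.Resolution.DiffStableAdjoin
import Literature.AlgebraicGeometry.Resolution.PlaneNearForms
import Literature.AlgebraicGeometry.Resolution.HironakaDirectrixPolarTame
import HarnessLib

/-!
# The CJS directrix space of a principal homogeneous ideal is Hironaka's directrix of its generator:
# `𝒯((h)) = T({h})`, `e((h)) = d − τ({h})` (CJS Lemma 2.7 / Def. 2.8 vs Cossart–Piltant Prop. 4.2)

Topic: `Literature/AlgebraicGeometry/Resolution`. Sequel of `HironakaDirectrixIdeal.lean`, which proves CJS Lemma 2.7 in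
the form `𝒯(I) ⊆ T(S)` for every generating set `S` of `I` and `𝒯(I) = T(S)` for SOME generating set:

> **CJS 2020, Lemma 2.7 / Def. 2.8.** "`𝒯(I, K) ⊆ (S₁)_K` … the minimal `K`-subspace such that `I_K` is generated by
> elements in `K[𝒯(I, K)]`"; "`e(S/I) = n − dim 𝒯(I)`". **Cossart–Piltant 2008, proof of Prop. 4.2**: `T_x` the
> minimal subspace with `J_x ⊆ k(x)[T_x]`, `τ(x) := dim T_x` (Hironaka's intrinsic definition of the directrix).

PROVED here: for a PRINCIPAL homogeneous ideal the infimum is attained at the generator —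
`directrixSpace_span_singleton_eq_map_directrix`: `𝒯((h)) = T({h})` for every nonzero form `h` (every characteristic;
if `k[T']` directs `(h)` then `h ∈ k[T']` by graded bookkeeping, `mem_linearFormsSubalgebra_of_span_singleton_eq`), hence
`finrank_directrixSpace_span_singleton` (`dim 𝒯((h)) = τ({h})`), `directrixDim_span_singleton` (`e((h)) = d − τ({h})`),
and in TAME degree (`HironakaDirectrixPolarTame.lean`) `directrixDim_span_singleton_eq_sub_finrank_span_pderiv`:
`e((h)) = d − dim ⟨∂h/∂Y_i⟩`.

First landed summit-side (cell res-hironaka, `CampaignW46.PrincipalDirectrix`); ported here as the principal-ideal case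
of the CJS/Hironaka dictionary. AI-written; AI review is weaker than expert review.

## References

* V. Cossart, U. Jannsen, S. Saito, LNM 2270 (2020), Lemma 2.7, Def. 2.8. [CossartJannsenSaito2020]
* V. Cossart, O. Piltant, J. Algebra 320 (2008), proof of Prop. 4.2. [CossartPiltant2008]
-/

noncomputable section

open MvPolynomial
open Literature.RingTheory.MvPolynomial

namespace Literature.AlgebraicGeometry.Resolution

universe u

variable {k : Type u} [Field k] {d : ℕ}

/-- The degree-`b` component of a multiple of a form of degree `b`: `(q · h)_b = q(0) · h`. [folklore] -/
private theorem homogeneousComponent_mul_of_isHomogeneous_self {h : MvPolynomial (Fin d) k} {b : ℕ} (hh : h.IsHomogeneous b)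
    (q : MvPolynomial (Fin d) k) : homogeneousComponent b (q * h) = C (coeff 0 q) * h := by
  classical
  have hq : q * h = ∑ i ∈ Finset.range (q.totalDegree + 1), homogeneousComponent i q * h := by
    rw [← Finset.sum_mul, sum_homogeneousComponent]
  rw [hq, map_sum, Finset.sum_eq_single 0]
  · rw [homogeneousComponent_zero, homogeneousComponent_of_mem
      ((mem_homogeneousSubmodule _ _).mpr ((isHomogeneous_C _ (coeff 0 q)).mul hh)), if_pos (zero_add b).symm]
  · intro i _ hi0
    rw [homogeneousComponent_of_mem
      ((mem_homogeneousSubmodule _ _).mpr ((homogeneousComponent_isHomogeneous i q).mul hh)), if_neg (by omega)]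
  · intro h0
    exact absurd (Finset.mem_range.mpr (Nat.succ_pos _)) h0

/-- **A space of linear forms whose algebra generates the principal ideal of a nonzero form contains the form in its
algebra**: if `(h) = (S)` with `S ⊆ k[T']`, then `h ∈ k[T']` (CJS Lemma 2.7's minimality, principal case).
[cite: CossartJannsenSaito2020, Lemma 2.7] -/
theorem mem_linearFormsSubalgebra_of_span_singleton_eq {h : MvPolynomial (Fin d) k} {b : ℕ} (hh : h.IsHomogeneous b)
    (h0 : h ≠ 0) {T' : Submodule k (Module.Dual k (Fin d → k))} {S : Set (MvPolynomial (Fin d) k)}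
    (hSU : S ⊆ linearFormsSubalgebra k T') (hSI : Ideal.span S = Ideal.span {h}) :
    h ∈ linearFormsSubalgebra k T' := by
  classical
  set U := linearFormsSubalgebra k T' with hU
  -- `U` is graded
  have hgr : IsGradedSubalgebra U := by
    rw [hU, linearFormsSubalgebra]
    refine IsGradedSubalgebra.adjoin ?_
    rintro _ ⟨ℓ, _, rfl⟩
    exact ⟨1, isHomogeneous_linearFormPoly ℓ⟩
  -- `h = Σ_s c_s • s` with `s ∈ S`
  have hmem : h ∈ Ideal.span S := by rw [hSI]; exact Ideal.mem_span_singleton_self h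
  obtain ⟨c, hcS, hsum⟩ := (Submodule.mem_span_set (R := MvPolynomial (Fin d) k)).mp hmem
  -- each `s` in the support is a multiple of `h`
  have hg : ∀ s ∈ c.support, ∃ g : MvPolynomial (Fin d) k, g * h = s := fun s hs =>
    Ideal.mem_span_singleton'.mp (hSI ▸ Ideal.subset_span (hcS hs))
  choose! g hg using hg
  -- degree-`b` components: `h = (Σ_s (c s · g s)(0)) · h`
  have hcomp : h = C (∑ s ∈ c.support, coeff 0 (c s * g s)) * h := by
    conv_lhs => rw [← (homogeneousComponent_of_mem ((mem_homogeneousSubmodule _ _).mpr hh)).trans (if_pos rfl),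
      ← hsum]
    rw [Finsupp.sum, map_sum, map_sum, Finset.sum_mul]
    refine Finset.sum_congr rfl fun s hs => ?_
    calc homogeneousComponent b (c s • s) = homogeneousComponent b ((c s * g s) * h) := by
          rw [smul_eq_mul, mul_assoc, hg s hs]
      _ = C (coeff 0 (c s * g s)) * h := homogeneousComponent_mul_of_isHomogeneous_self hh _
  -- hence some `g s₀` has a nonzero constant term
  obtain ⟨s₀, hs₀, hc₀⟩ : ∃ s₀ ∈ c.support, coeff 0 (g s₀) ≠ 0 := by
    by_contra hall
    push Not at hall
    have hzero : (∑ s ∈ c.support, coeff 0 (c s * g s)) = 0 :=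
      Finset.sum_eq_zero fun s hs => by
        rw [← constantCoeff_eq, RingHom.map_mul, constantCoeff_eq, hall s hs, mul_zero]
    rw [hzero, C_0, zero_mul] at hcomp
    exact h0 hcomp
  -- `(s₀)_b = g(s₀)(0) · h ∈ U`, so `h ∈ U`
  have hs₀U : homogeneousComponent b (s₀ : MvPolynomial (Fin d) k) ∈ U := hgr _ (hSU (hcS hs₀)) b
  rw [← hg s₀ hs₀, homogeneousComponent_mul_of_isHomogeneous_self hh] at hs₀U
  have hinv : C (coeff 0 (g s₀))⁻¹ * (C (coeff 0 (g s₀)) * h) = h := by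
    rw [← mul_assoc, ← map_mul, inv_mul_cancel₀ hc₀, C_1, one_mul]
  rw [← hinv]
  exact U.mul_mem (U.algebraMap_mem _) hs₀U

/-- **`𝒯((h)) = T({h})` for a nonzero form `h`** (every characteristic): the CJS directrix space of the principal
homogeneous ideal `(h)` is the image of Hironaka's directrix of `{h}` under the encoding `linearFormPolyₗ`.
[cite: CossartJannsenSaito2020, Lemma 2.7] [cite: CossartPiltant2008, proof of Prop. 4.2] -/
theorem directrixSpace_span_singleton_eq_map_directrix {h : MvPolynomial (Fin d) k} {b : ℕ} (hh : h.IsHomogeneous b)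
    (h0 : h ≠ 0) :
    directrixSpace (Ideal.span {h}) = (directrix k ({h} : Set (MvPolynomial (Fin d) k))).map (linearFormPolyₗ k) := by
  refine le_antisymm (directrixSpace_le_map_directrix rfl) ?_
  set I : Ideal (MvPolynomial (Fin d) k) := Ideal.span {h} with hI
  set T' := (directrixSpace I).comap (linearFormPolyₗ k) with hT'
  have hmap : T'.map (linearFormPolyₗ k) = directrixSpace I :=
    map_comap_linearFormPolyₗ k (directrixSpace_le_one I)
  have hdir : Directs I (T'.map (linearFormPolyₗ k)) := by
    rw [hmap]
    exact directs_directrixSpace I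
  obtain ⟨S, hSU, hSI⟩ := directs_map_iff.mp hdir
  have hhU : h ∈ linearFormsSubalgebra k T' := mem_linearFormsSubalgebra_of_span_singleton_eq hh h0 hSU hSI
  have hle : directrix k ({h} : Set (MvPolynomial (Fin d) k)) ≤ T' :=
    directrix_le_of_subset k (Set.singleton_subset_iff.mpr hhU)
  calc (directrix k ({h} : Set (MvPolynomial (Fin d) k))).map (linearFormPolyₗ k)
      ≤ T'.map (linearFormPolyₗ k) := Submodule.map_mono hle
    _ = directrixSpace I := hmap

/-- **`dim_k 𝒯((h)) = τ({h})`** for a nonzero form `h` (every characteristic).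
[cite: CossartJannsenSaito2020, Def. 2.8] [cite: CossartPiltant2008, proof of Prop. 4.2] -/
theorem finrank_directrixSpace_span_singleton {h : MvPolynomial (Fin d) k} {b : ℕ} (hh : h.IsHomogeneous b)
    (h0 : h ≠ 0) :
    Module.finrank k (directrixSpace (Ideal.span {h})) = hironakaTau k ({h} : Set (MvPolynomial (Fin d) k)) := by
  rw [directrixSpace_span_singleton_eq_map_directrix hh h0, finrank_map_directrix]

/-- **`e((h)) = d − τ({h})`**: the CJS dimension of the directrix of the cone of a nonzero form is computed by
Hironaka's `τ` of the form (every characteristic). [cite: CossartJannsenSaito2020, Def. 2.8] -/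
theorem directrixDim_span_singleton {h : MvPolynomial (Fin d) k} {b : ℕ} (hh : h.IsHomogeneous b) (h0 : h ≠ 0) :
    directrixDim (Ideal.span {h}) = d - hironakaTau k ({h} : Set (MvPolynomial (Fin d) k)) := by
  rw [directrixDim, finrank_directrixSpace_span_singleton hh h0]

/-- **Tame degree: `e((h)) = d − dim ⟨∂h/∂Y_i⟩`** for a nonzero form `h` with `1, …, deg h` non-zero in `k`
(`HironakaDirectrixPolarTame.hironakaTau_singleton_eq_finrank_span_pderiv`).
[cite: CossartJannsenSaito2020, Def. 2.8] [cite: BerthomieuHivertMourtada2010, Algorithm 3.5] -/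
theorem directrixDim_span_singleton_eq_sub_finrank_span_pderiv {h : MvPolynomial (Fin d) k} {b : ℕ}
    (hh : h.IsHomogeneous b) (h0 : h ≠ 0) (hchar : ∀ m : ℕ, 1 ≤ m → m ≤ h.totalDegree → (m : k) ≠ 0) :
    directrixDim (Ideal.span {h}) =
      d - Module.finrank k (Submodule.span k (Set.range fun i : Fin d => pderiv i h)) := by
  rw [directrixDim_span_singleton hh h0, hironakaTau_singleton_eq_finrank_span_pderiv k h hchar]

/-- **Characteristic `p > deg h`** version. [cite: CossartJannsenSaito2020, Def. 2.8] -/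
theorem directrixDim_span_singleton_eq_sub_finrank_span_pderiv_of_lt_char (p : ℕ) [CharP k p]
    {h : MvPolynomial (Fin d) k} {b : ℕ} (hh : h.IsHomogeneous b) (h0 : h ≠ 0) (hp : h.totalDegree < p) :
    directrixDim (Ideal.span {h}) =
      d - Module.finrank k (Submodule.span k (Set.range fun i : Fin d => pderiv i h)) :=
  directrixDim_span_singleton_eq_sub_finrank_span_pderiv hh h0 (fun m h1 hm => by
    rw [Ne, CharP.cast_eq_zero_iff k p m]
    exact fun hdvd => absurd (Nat.le_of_dvd (by omega) hdvd) (by omega))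

end Literature.AlgebraicGeometry.Resolution

end
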